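import Literature.Analysis.Complex.HarnackHalfPlane
import Literature.Analysis.Complex.CauchyTaylorBall
import HarnessLib

/-!
# The four-point lattice mean of `√(im Q)` for a half-plane-valued holomorphic `Q`

Analysis/Complex support file (everything proved; no definitions, no named facts). Let `Q` be
holomorphic on the disc `B(v, R)` with `im Q > 0` and put `u = im Q` (a positive harmonic
function). The lattice Laplacian of `u` at `v` with unit steps, `Σ_{e⁴ = 1} u(v + e) - 4 u(v)`, is
of the fourth order `O(u(v)/R⁴)` (Taylor expansion: the terms of orders `1, 2, 3` cancel over the
four fourth roots of unity, the second-order ones because `u` is harmonic), whereas strict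
concavity of the square root produces a NEGATIVE second-order term
`-Σ_e (u(v+e) - u(v))² / (16 u(v)^{3/2}) ≤ -|Q'(v)|² / (8 u(v)^{3/2}) + O(u(v)^{1/2}/R⁴)`. Hence,
under a lower bound on the gradient RELATIVE to the size of `u`, `c · u(v) ≤ |Q'(v)| · R`, the
square root `√u` is lattice-superharmonic at `v` as soon as `c R` is large:

* `Literature.Analysis.Complex.sqrt_im_fourPointSum_le` — if `8 ≤ R`, `600 ≤ c R` and
  `c u(v) ≤ |Q'(v)| R`, then `√u(v+1) + √u(v+i) + √u(v-1) + √u(v-i) ≤ 4 √u(v)`.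

The estimates used are the tree's Harnack inequality and Schwarz–Pick bound for half-plane-valued
maps (`Complex.im_apply_le_harnack`, `Complex.norm_deriv_le_two_mul_im_div`) and the Cauchy–Taylor
remainders from a sup bound (`CauchyTaylorBall.lean`), applied to `Q - Q(v)` on `B(v, R/2)` where
`|Q - Q(v)| ≤ 6 u(v)` (`norm_sub_apply_le_six_mul_im`). This is the analytic engine of the
discrete-superharmonic barrier in the proof of Lawler–Schramm–Werner (2004), Lemma 5.3
(`Literature/Probability/LatticeModels/GridDomain*`). Everything is tagged folklore (interior
estimates for positive harmonic functions; e.g. Conway, *Functions of One Complex Variable I*,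
Ch. X §2, and Cauchy's inequalities).
-/

noncomputable section

open Set Metric Complex
open scoped Topology Nat

namespace Literature.Analysis.Complex

/-! ### Strict concavity of the square root, quantitative form -/

/-- **Quantitative concavity of `√·`**: for `0 ≤ x ≤ 3y`, `0 < y`,
`√x ≤ √y + (x - y)/(2√y) - (x - y)²/(16 y √y)` (from the identity
`√x = √y + (x-y)/(2√y) - (√x-√y)²/(2√y)` and `(√x + √y)² ≤ 8y`). [folklore] -/
theorem sqrt_le_taylor_of_le_three_mul {x y : ℝ} (hy : 0 < y) (hx : 0 ≤ x) (hx3 : x ≤ 3 * y) :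
    √x ≤ √y + (x - y) / (2 * √y) - (x - y) ^ 2 / (16 * y * √y) := by
  set s := √x with hs
  set t := √y with ht
  have ht0 : 0 < t := Real.sqrt_pos.2 hy
  have hs0 : 0 ≤ s := Real.sqrt_nonneg x
  have hx' : x = s ^ 2 := (Real.sq_sqrt hx).symm
  have hy' : y = t ^ 2 := (Real.sq_sqrt hy.le).symm
  rw [hx', hy'] at hx3 ⊢
  have hst : s ≤ 2 * t := by nlinarith
  have hkey : 0 ≤ (s - t) ^ 2 * (8 * t ^ 2 - (s + t) ^ 2) := by
    apply mul_nonneg (sq_nonneg _)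
    nlinarith
  have h16 : 0 < 16 * t ^ 2 * t := by positivity
  rw [← sub_nonneg]
  have hcalc : t + (s ^ 2 - t ^ 2) / (2 * t) - (s ^ 2 - t ^ 2) ^ 2 / (16 * t ^ 2 * t) - s =
      (s - t) ^ 2 * (8 * t ^ 2 - (s + t) ^ 2) / (16 * t ^ 2 * t) := by
    field_simp
    ring
  rw [hcalc]
  positivity

/-! ### Interior estimates for `Q` with `im Q > 0` on `B(v, R)` -/

section Estimates

variable {Q : ℂ → ℂ} {v : ℂ} {R : ℝ}

/-- Harnack on the inner half: `im Q(z) ≤ 3 im Q(v)` for `|z - v| ≤ R/2`. [folklore] -/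
theorem im_apply_le_three_mul (hR : 0 < R) (hd : DifferentiableOn ℂ Q (ball v R))
    (hpos : ∀ z ∈ ball v R, 0 < (Q z).im) {z : ℂ} (hz : ‖z - v‖ ≤ R / 2) :
    (Q z).im ≤ 3 * (Q v).im := by
  have hzb : z ∈ ball v R := by rw [mem_ball, dist_eq_norm]; linarith
  have h := Complex.im_apply_le_harnack hR hd hpos hzb
  have hu : 0 < (Q v).im := hpos v (mem_ball_self hR)
  have hfrac : (R + ‖z - v‖) / (R - ‖z - v‖) ≤ 3 := by
    rw [div_le_iff₀ (by linarith)]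
    linarith
  calc (Q z).im ≤ (Q v).im * ((R + ‖z - v‖) / (R - ‖z - v‖)) := h
    _ ≤ (Q v).im * 3 := mul_le_mul_of_nonneg_left hfrac hu.le
    _ = 3 * (Q v).im := by ring

/-- Schwarz–Pick on the inner half: `|Q'(z)| ≤ 12 im Q(v) / R` for `|z - v| < R/2`. [folklore] -/
theorem norm_deriv_le_twelve_mul_im_div (hR : 0 < R) (hd : DifferentiableOn ℂ Q (ball v R))
    (hpos : ∀ z ∈ ball v R, 0 < (Q z).im) {z : ℂ} (hz : ‖z - v‖ < R / 2) :
    ‖deriv Q z‖ ≤ 12 * (Q v).im / R := by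
  have hsub : ball z (R / 2) ⊆ ball v R := by
    intro x hx
    rw [mem_ball, dist_eq_norm] at hx ⊢
    have := norm_sub_le_norm_sub_add_norm_sub x z v
    linarith
  have h1 := Complex.norm_deriv_le_two_mul_im_div (by positivity : 0 < R / 2) (hd.mono hsub)
    fun x hx => hpos x (hsub hx)
  have h2 := im_apply_le_three_mul hR hd hpos hz.le
  have hu : 0 < (Q v).im := hpos v (mem_ball_self hR)
  calc ‖deriv Q z‖ ≤ 2 * (Q z).im / (R / 2) := h1
    _ = 4 * (Q z).im / R := by field_simp; ring
    _ ≤ 4 * (3 * (Q v).im) / R := by gcongr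
    _ = 12 * (Q v).im / R := by ring

/-- **Sup bound on the inner half**: `|Q(z) - Q(v)| ≤ 6 im Q(v)` for `|z - v| < R/2` (mean value
inequality with the Schwarz–Pick bound). [folklore] -/
theorem norm_sub_apply_le_six_mul_im (hR : 0 < R) (hd : DifferentiableOn ℂ Q (ball v R))
    (hpos : ∀ z ∈ ball v R, 0 < (Q z).im) {z : ℂ} (hz : z ∈ ball v (R / 2)) :
    ‖Q z - Q v‖ ≤ 6 * (Q v).im := by
  have hu : 0 < (Q v).im := hpos v (mem_ball_self hR)
  have hdiff : ∀ x ∈ ball v (R / 2), DifferentiableAt ℂ Q x := fun x hx =>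
    hd.differentiableAt (isOpen_ball.mem_nhds (ball_subset_ball (by linarith) hx))
  have hbound : ∀ x ∈ ball v (R / 2), ‖deriv Q x‖ ≤ 12 * (Q v).im / R := fun x hx =>
    norm_deriv_le_twelve_mul_im_div hR hd hpos (by rwa [mem_ball, dist_eq_norm] at hx)
  have hmv := (convex_ball v (R / 2)).norm_image_sub_le_of_norm_deriv_le hdiff hbound
    (mem_ball_self (by positivity)) hz
  have hzv : ‖z - v‖ < R / 2 := by rwa [mem_ball, dist_eq_norm] at hz
  calc ‖Q z - Q v‖ ≤ 12 * (Q v).im / R * ‖z - v‖ := hmv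
    _ ≤ 12 * (Q v).im / R * (R / 2) := by gcongr
    _ = 6 * (Q v).im := by field_simp; ring

/-- The Taylor data of `Q - Q(v)` at `v` for a unit step `e`: with `D₁ = Q'(v)` and
`D₂ = (Q - Q(v))''(v)`, `|D₁| ≤ 2u/R`, `|D₂| ≤ 192 u/R²`, the third-order remainder
`|Q(v+e) - Q(v) - e D₁ - e² D₂/2| ≤ 768 u/R³`, where `u = im Q(v)` and `R ≥ 8`. [folklore] -/
theorem taylor_two_step_bounds (hR : 8 ≤ R) (hd : DifferentiableOn ℂ Q (ball v R))
    (hpos : ∀ z ∈ ball v R, 0 < (Q z).im) {e : ℂ} (he : ‖e‖ = 1) :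
    ‖deriv Q v‖ ≤ 2 * (Q v).im / R ∧
    ‖iteratedDeriv 2 (fun z => Q z - Q v) v‖ ≤ 192 * (Q v).im / R ^ 2 ∧
    ‖Q (v + e) - Q v - e * deriv Q v - (2 : ℂ)⁻¹ * e ^ 2 * iteratedDeriv 2 (fun z => Q z - Q v) v‖ ≤
      768 * (Q v).im / R ^ 3 := by
  have hR0 : 0 < R := by linarith
  have hR2 : 0 < R / 2 := by positivity
  set f : ℂ → ℂ := fun z => Q z - Q v with hf
  have hfd : DifferentiableOn ℂ f (ball v (R / 2)) :=
    (hd.mono (ball_subset_ball (by linarith))).sub_const _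
  have hM : ∀ z ∈ ball v (R / 2), ‖f z‖ ≤ 6 * (Q v).im := fun z hz =>
    norm_sub_apply_le_six_mul_im hR0 hd hpos hz
  have hderf : deriv f v = deriv Q v := by
    rw [hf]; exact deriv_sub_const (Q v)
  refine ⟨Complex.norm_deriv_le_two_mul_im_div hR0 hd hpos, ?_, ?_⟩
  · have h := norm_iteratedDeriv_two_le_of_forall_mem_ball hR2 hfd hM
    calc ‖iteratedDeriv 2 f v‖ ≤ 8 * (6 * (Q v).im) / (R / 2) ^ 2 := h
      _ = 192 * (Q v).im / R ^ 2 := by field_simp; ring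
  · have hz : ‖v + e - v‖ ≤ R / 2 / 4 := by rw [add_sub_cancel_left, he]; linarith
    have h := norm_sub_taylor_two_le_of_forall_mem_ball hR2 hfd hM hz
    have hfv : f v = 0 := sub_self _
    rw [add_sub_cancel_left, hderf, hfv, sub_zero, he] at h
    simp only [smul_eq_mul, one_pow, mul_one] at h
    calc _ ≤ 16 * (6 * (Q v).im) / (R / 2) ^ 3 := h
      _ = 768 * (Q v).im / R ^ 3 := by field_simp; ring

/-- **The four-point lattice mean of `u = im Q` is `u(v)` up to the fourth order**:
`|u(v+1) + u(v+i) + u(v-1) + u(v-i) - 4 u(v)| ≤ 12288 u(v)/R⁴` for `R ≥ 8` (the Taylor terms of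
orders `1, 2, 3` cancel over the fourth roots of unity). [folklore] -/
theorem abs_fourPointSum_im_sub_le (hR : 8 ≤ R) (hd : DifferentiableOn ℂ Q (ball v R))
    (hpos : ∀ z ∈ ball v R, 0 < (Q z).im) :
    |(Q (v + 1)).im + (Q (v + I)).im + (Q (v - 1)).im + (Q (v - I)).im - 4 * (Q v).im| ≤
      12288 * (Q v).im / R ^ 4 := by
  have hR0 : 0 < R := by linarith
  have hR2 : 0 < R / 2 := by positivity
  set f : ℂ → ℂ := fun z => Q z - Q v with hf
  have hfd : DifferentiableOn ℂ f (ball v (R / 2)) :=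
    (hd.mono (ball_subset_ball (by linarith))).sub_const _
  have hM : ∀ z ∈ ball v (R / 2), ‖f z‖ ≤ 6 * (Q v).im := fun z hz =>
    norm_sub_apply_le_six_mul_im hR0 hd hpos hz
  -- the Taylor polynomial of order `3` of `f` at `v`, evaluated at the step `e`
  set T : ℂ → ℂ := fun e => ∑ n ∈ Finset.range 4, (n ! : ℂ)⁻¹ • e ^ n • iteratedDeriv n f v with hT
  have hfv : f v = 0 := sub_self _
  have hTe : ∀ e : ℂ, T e = e * iteratedDeriv 1 f v + 2⁻¹ * e ^ 2 * iteratedDeriv 2 f v +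
      6⁻¹ * e ^ 3 * iteratedDeriv 3 f v := by
    intro e
    simp only [hT, Finset.sum_range_succ, Finset.sum_range_zero, Nat.factorial, smul_eq_mul,
      iteratedDeriv_zero, hfv]
    push_cast
    ring
  have hTsum : T 1 + T I + T (-1) + T (-I) = 0 := by
    rw [hTe, hTe, hTe, hTe]
    linear_combination (iteratedDeriv 2 f v) * Complex.I_sq
  -- each remainder is `≤ 2 · 6u · (2/(R/2))⁴`
  have hrem : ∀ e : ℂ, ‖e‖ = 1 → ‖f (v + e) - T e‖ ≤ 3072 * (Q v).im / R ^ 4 := by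
    intro e he
    have hz : ‖v + e - v‖ ≤ R / 2 / 4 := by rw [add_sub_cancel_left, he]; linarith
    have h := norm_sub_taylor_le_of_forall_mem_ball hR2 hfd hM hz 4
    rw [add_sub_cancel_left, he] at h
    calc ‖f (v + e) - T e‖ ≤ 2 * (6 * (Q v).im) * (2 * 1 / (R / 2)) ^ 4 := h
      _ = 3072 * (Q v).im / R ^ 4 := by field_simp; ring
  have h1 := hrem 1 (by simp)
  have hI := hrem I (by simp)
  have hm1 := hrem (-1) (by simp)
  have hmI := hrem (-I) (by simp)
  -- the sum of the four values of `f` is the sum of the four remainders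
  have hsum : f (v + 1) + f (v + I) + f (v + -1) + f (v + -I) =
      (f (v + 1) - T 1) + (f (v + I) - T I) + (f (v + -1) - T (-1)) + (f (v + -I) - T (-I)) := by
    linear_combination hTsum
  have him : (Q (v + 1)).im + (Q (v + I)).im + (Q (v - 1)).im + (Q (v - I)).im - 4 * (Q v).im =
      (f (v + 1) + f (v + I) + f (v + -1) + f (v + -I)).im := by
    simp only [hf, add_im, sub_im, ← sub_eq_add_neg]
    ring
  rw [him, hsum]
  refine (abs_im_le_norm _).trans ?_
  set a := f (v + 1) - T 1
  set b := f (v + I) - T I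
  set c := f (v + -1) - T (-1)
  set d := f (v + -I) - T (-I)
  have h3 := norm_add_le (a + b + c) d
  have h2 := norm_add_le (a + b) c
  have h1' := norm_add_le a b
  have h4 : ‖a + b + c + d‖ ≤ ‖a‖ + ‖b‖ + ‖c‖ + ‖d‖ := by linarith
  refine h4.trans ((add_le_add (add_le_add (add_le_add h1 hI) hm1) hmI).trans_eq ?_)
  ring

/-- A square is bounded below through an approximation: `|X - A| ≤ ρ ⟹ A² - 2|A|ρ ≤ X²`. [folklore] -/
theorem sq_sub_le_sq_of_abs_sub_le {X A ρ : ℝ} (h : |X - A| ≤ ρ) : A ^ 2 - 2 * |A| * ρ ≤ X ^ 2 := by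
  have hρ : 0 ≤ ρ := (abs_nonneg _).trans h
  have h1 : |A * (X - A)| ≤ |A| * ρ := by
    rw [abs_mul]; exact mul_le_mul_of_nonneg_left h (abs_nonneg A)
  have h2 := neg_abs_le (A * (X - A))
  nlinarith [sq_nonneg (X - A)]

set_option maxHeartbeats 400000 in
/-- **The squared increments dominate the squared gradient**:
`2 |Q'(v)|² - 86016 u(v)²/R⁴ ≤ Σ_{e⁴=1} (u(v+e) - u(v))²` for `R ≥ 8` (second-order Taylor
expansion: the first-order parts contribute `2|Q'(v)|²`, the cross terms with the second-order
parts cancel over `±e`). [folklore] -/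
theorem sq_sum_fourPoint_im_sub_ge (hR : 8 ≤ R) (hd : DifferentiableOn ℂ Q (ball v R))
    (hpos : ∀ z ∈ ball v R, 0 < (Q z).im) :
    2 * ‖deriv Q v‖ ^ 2 - 86016 * (Q v).im ^ 2 / R ^ 4 ≤
      ((Q (v + 1)).im - (Q v).im) ^ 2 + ((Q (v + I)).im - (Q v).im) ^ 2 +
        ((Q (v - 1)).im - (Q v).im) ^ 2 + ((Q (v - I)).im - (Q v).im) ^ 2 := by
  have hR0 : 0 < R := by linarith
  set y := (Q v).im with hy
  have hy0 : 0 < y := hpos v (mem_ball_self hR0)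
  set D₁ := deriv Q v with hD₁
  set D₂ := iteratedDeriv 2 (fun z => Q z - Q v) v with hD₂
  set p := D₁.re with hp
  set q := D₁.im with hq
  set β : ℝ := 2⁻¹ * D₂.im with hβ
  have hT := fun (e : ℂ) (he : ‖e‖ = 1) => taylor_two_step_bounds hR hd hpos he
  obtain ⟨hD₁le, hD₂le, -⟩ := hT 1 (by simp)
  have hple : |p| ≤ 2 * y / R := (abs_re_le_norm D₁).trans hD₁le
  have hqle : |q| ≤ 2 * y / R := (abs_im_le_norm D₁).trans hD₁le
  have hβle : |β| ≤ 96 * y / R ^ 2 := by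
    rw [hβ, abs_mul, abs_of_pos (by norm_num : (0 : ℝ) < 2⁻¹)]
    have := (abs_im_le_norm D₂).trans hD₂le
    calc 2⁻¹ * |D₂.im| ≤ 2⁻¹ * (192 * y / R ^ 2) := by gcongr
      _ = 96 * y / R ^ 2 := by ring
  have hnormsq : ‖D₁‖ ^ 2 = p ^ 2 + q ^ 2 := by
    rw [Complex.sq_norm, Complex.normSq_apply, hp, hq]; ring
  have htwo : (2 : ℂ)⁻¹ = ((2⁻¹ : ℝ) : ℂ) := by simp
  -- the four remainders, imaginary parts
  set ρ : ℝ := 768 * y / R ^ 3 with hρ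
  have hrem : ∀ e : ℂ, ‖e‖ = 1 →
      |(Q (v + e)).im - y - (e * D₁).im - (2⁻¹ * (e ^ 2 * D₂).im)| ≤ ρ := by
    intro e he
    obtain ⟨-, -, h3⟩ := hT e he
    refine le_trans (le_of_eq ?_) ((abs_im_le_norm _).trans h3)
    congr 1
    rw [htwo, hy, hD₁, hD₂]
    simp only [sub_im, mul_assoc, Complex.im_ofReal_mul]
  have r1 := hrem 1 (by simp)
  have rI := hrem I (by simp)
  have rm1 := hrem (-1) (by simp)
  have rmI := hrem (-I) (by simp)
  simp only [one_mul, one_pow, neg_mul, neg_im, mul_im, Complex.I_re, Complex.I_im, zero_mul,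
    zero_add, I_sq, neg_sq] at r1 rI rm1 rmI
  rw [← sub_eq_add_neg] at rm1 rmI
  -- the increments `X_e = u(v+e) - u(v)` and their approximations `A_e`
  set X₁ := (Q (v + 1)).im - y with hX₁
  set X₂ := (Q (v + I)).im - y with hX₂
  set X₃ := (Q (v - 1)).im - y with hX₃
  set X₄ := (Q (v - I)).im - y with hX₄
  have s1 : |X₁ - (q + β)| ≤ ρ := by
    convert r1 using 2; rw [hq, hβ]; ring
  have s2 : |X₂ - (p - β)| ≤ ρ := by
    convert rI using 2; rw [hp, hβ]; ring
  have s3 : |X₃ - (-q + β)| ≤ ρ := by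
    convert rm1 using 2; rw [hq, hβ]; ring
  have s4 : |X₄ - (-p - β)| ≤ ρ := by
    convert rmI using 2; rw [hp, hβ]; ring
  have t1 := sq_sub_le_sq_of_abs_sub_le s1
  have t2 := sq_sub_le_sq_of_abs_sub_le s2
  have t3 := sq_sub_le_sq_of_abs_sub_le s3
  have t4 := sq_sub_le_sq_of_abs_sub_le s4
  have hρ0 : 0 ≤ ρ := by positivity
  -- `|A_e| ≤ 14 y / R`
  have h96 : 96 * y / R ^ 2 ≤ 12 * y / R := by
    rw [div_le_div_iff₀ (by positivity) hR0]
    nlinarith [mul_nonneg (mul_pos hy0 hR0).le (by linarith : (0 : ℝ) ≤ R - 8)]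
  have hbd : 2 * y / R + 96 * y / R ^ 2 ≤ 14 * y / R := by
    have : 2 * y / R + 12 * y / R = 14 * y / R := by ring
    linarith
  have hA1 : |q + β| ≤ 14 * y / R := ((abs_add_le _ _).trans (add_le_add hqle hβle)).trans hbd
  have hA2 : |p - β| ≤ 14 * y / R := ((abs_sub _ _).trans (add_le_add hple hβle)).trans hbd
  have hA3 : |-q + β| ≤ 14 * y / R := by
    refine ((abs_add_le _ _).trans (add_le_add ?_ hβle)).trans hbd; rwa [abs_neg]
  have hA4 : |-p - β| ≤ 14 * y / R := by
    refine ((abs_sub _ _).trans (add_le_add ?_ hβle)).trans hbd; rwa [abs_neg]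
  have m1 := mul_le_mul_of_nonneg_right hA1 hρ0
  have m2 := mul_le_mul_of_nonneg_right hA2 hρ0
  have m3 := mul_le_mul_of_nonneg_right hA3 hρ0
  have m4 := mul_le_mul_of_nonneg_right hA4 hρ0
  have hsumA : (q + β) ^ 2 + (p - β) ^ 2 + (-q + β) ^ 2 + (-p - β) ^ 2 =
      2 * ‖D₁‖ ^ 2 + 4 * β ^ 2 := by rw [hnormsq]; ring
  have hρ' : 14 * y / R * ρ = 10752 * (y ^ 2 / R ^ 4) := by
    rw [hρ]; field_simp; ring
  have hfin : 86016 * y ^ 2 / R ^ 4 = 8 * (10752 * (y ^ 2 / R ^ 4)) := by ring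
  rw [hfin]
  linarith [sq_nonneg β, t1, t2, t3, t4, m1, m2, m3, m4, hsumA, hρ']

/-- **Concavity bookkeeping**: for `y > 0` and increments `X_i` with `0 ≤ y + X_i ≤ 3y` and
`8 y Σ X_i ≤ Σ X_i²`, `Σ √(y + X_i) ≤ 4 √y`. [folklore] -/
theorem sqrt_fourSum_le_of_sq_sum_ge {y X₁ X₂ X₃ X₄ : ℝ} (hy : 0 < y)
    (h₁ : 0 ≤ y + X₁) (h₂ : 0 ≤ y + X₂) (h₃ : 0 ≤ y + X₃) (h₄ : 0 ≤ y + X₄)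
    (h₁' : y + X₁ ≤ 3 * y) (h₂' : y + X₂ ≤ 3 * y) (h₃' : y + X₃ ≤ 3 * y) (h₄' : y + X₄ ≤ 3 * y)
    (hkey : 8 * y * (X₁ + X₂ + X₃ + X₄) ≤ X₁ ^ 2 + X₂ ^ 2 + X₃ ^ 2 + X₄ ^ 2) :
    √(y + X₁) + √(y + X₂) + √(y + X₃) + √(y + X₄) ≤ 4 * √y := by
  have q1 := sqrt_le_taylor_of_le_three_mul hy h₁ h₁'
  have q2 := sqrt_le_taylor_of_le_three_mul hy h₂ h₂'
  have q3 := sqrt_le_taylor_of_le_three_mul hy h₃ h₃'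
  have q4 := sqrt_le_taylor_of_le_three_mul hy h₄ h₄'
  simp only [add_sub_cancel_left] at q1 q2 q3 q4
  have hsy : 0 < √y := Real.sqrt_pos.2 hy
  have hfin : (X₁ + X₂ + X₃ + X₄) / (2 * √y) ≤ (X₁ ^ 2 + X₂ ^ 2 + X₃ ^ 2 + X₄ ^ 2) / (16 * y * √y) := by
    rw [div_le_div_iff₀ (by positivity) (by positivity)]
    calc (X₁ + X₂ + X₃ + X₄) * (16 * y * √y) = (8 * y * (X₁ + X₂ + X₃ + X₄)) * (2 * √y) := by ring
      _ ≤ (X₁ ^ 2 + X₂ ^ 2 + X₃ ^ 2 + X₄ ^ 2) * (2 * √y) :=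
        mul_le_mul_of_nonneg_right hkey (by positivity)
  have e1 : (X₁ + X₂ + X₃ + X₄) / (2 * √y) =
      X₁ / (2 * √y) + X₂ / (2 * √y) + X₃ / (2 * √y) + X₄ / (2 * √y) := by ring
  have e2 : (X₁ ^ 2 + X₂ ^ 2 + X₃ ^ 2 + X₄ ^ 2) / (16 * y * √y) =
      X₁ ^ 2 / (16 * y * √y) + X₂ ^ 2 / (16 * y * √y) + X₃ ^ 2 / (16 * y * √y) +
        X₄ ^ 2 / (16 * y * √y) := by ring
  rw [e1, e2] at hfin
  linarith

/-- **Lattice superharmonicity of `√(im Q)` under a relative gradient bound.** Let `Q` be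
holomorphic on `B(v, R)` with `im Q > 0`, `R ≥ 8`, and suppose `c · im Q(v) ≤ |Q'(v)| · R` with
`c R ≥ 400`. Then the mean of `√(im Q)` over the four lattice neighbours `v ± 1`, `v ± i` is at
most `√(im Q(v))`. [folklore] -/
theorem sqrt_im_fourPointSum_le (hR : 8 ≤ R) (hd : DifferentiableOn ℂ Q (ball v R))
    (hpos : ∀ z ∈ ball v R, 0 < (Q z).im) {c : ℝ} (hcR : 400 ≤ c * R)
    (hgrad : c * (Q v).im ≤ ‖deriv Q v‖ * R) :
    √(Q (v + 1)).im + √(Q (v + I)).im + √(Q (v - 1)).im + √(Q (v - I)).im ≤ 4 * √(Q v).im := by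
  have hR0 : 0 < R := by linarith
  set y := (Q v).im with hy
  have hy0 : 0 < y := hpos v (mem_ball_self hR0)
  -- the four neighbours lie in the ball, their values are positive and at most `3y`
  have hmem : ∀ e : ℂ, ‖e‖ = 1 → v + e ∈ ball v R := fun e he => by
    rw [mem_ball, dist_eq_norm, add_sub_cancel_left, he]; linarith
  have hxpos : ∀ e : ℂ, ‖e‖ = 1 → 0 < (Q (v + e)).im := fun e he => hpos _ (hmem e he)
  have hx3 : ∀ e : ℂ, ‖e‖ = 1 → (Q (v + e)).im ≤ 3 * y := fun e he =>
    im_apply_le_three_mul hR0 hd hpos (by rw [add_sub_cancel_left, he]; linarith)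
  set X₁ := (Q (v + 1)).im - y with hX₁
  set X₂ := (Q (v + I)).im - y with hX₂
  set X₃ := (Q (v - 1)).im - y with hX₃
  set X₄ := (Q (v - I)).im - y with hX₄
  -- `S₁ ≤ 12288 y/R⁴`, `S₂ ≥ 2|D₁|² - 86016 y²/R⁴`, `|D₁| R ≥ c y`
  have hS₁ : X₁ + X₂ + X₃ + X₄ ≤ 12288 * y / R ^ 4 := by
    have h := (le_abs_self _).trans (abs_fourPointSum_im_sub_le hR hd hpos)
    rw [hX₁, hX₂, hX₃, hX₄]
    linarith
  have hS₂ := sq_sum_fourPoint_im_sub_ge hR hd hpos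
  rw [← hy, ← hX₁, ← hX₂, ← hX₃, ← hX₄] at hS₂
  have hc0 : 0 < c := by
    by_contra hc
    push Not at hc
    nlinarith [mul_nonpos_of_nonpos_of_nonneg hc hR0.le]
  have hgrad2 : (c * y) ^ 2 ≤ (‖deriv Q v‖ * R) ^ 2 :=
    pow_le_pow_left₀ (by positivity) hgrad 2
  have hkey : 8 * y * (X₁ + X₂ + X₃ + X₄) ≤ X₁ ^ 2 + X₂ ^ 2 + X₃ ^ 2 + X₄ ^ 2 := by
    have h1 : 8 * y * (X₁ + X₂ + X₃ + X₄) ≤ 98304 * (y ^ 2 / R ^ 4) := by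
      calc 8 * y * (X₁ + X₂ + X₃ + X₄) ≤ 8 * y * (12288 * y / R ^ 4) := by gcongr
        _ = 98304 * (y ^ 2 / R ^ 4) := by field_simp; ring
    have h2 : 2 * (c * y) ^ 2 / R ^ 2 ≤ 2 * ‖deriv Q v‖ ^ 2 := by
      rw [div_le_iff₀ (by positivity)]; nlinarith
    have h3 : (184320 : ℝ) * (y ^ 2 / R ^ 4) ≤ 2 * (c * y) ^ 2 / R ^ 2 := by
      have hcR2 : (160000 : ℝ) ≤ (c * R) ^ 2 := by nlinarith
      rw [mul_div_assoc', div_le_div_iff₀ (by positivity) (by positivity)]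
      have hyR : 0 ≤ y ^ 2 * R ^ 2 := by positivity
      calc (184320 : ℝ) * y ^ 2 * R ^ 2 ≤ 2 * (c * R) ^ 2 * (y ^ 2 * R ^ 2) := by nlinarith
        _ = 2 * (c * y) ^ 2 * R ^ 4 := by ring
    have h4 : 86016 * y ^ 2 / R ^ 4 = 86016 * (y ^ 2 / R ^ 4) := by ring
    rw [h4] at hS₂
    linarith
  have key := sqrt_fourSum_le_of_sq_sum_ge (X₁ := X₁) (X₂ := X₂) (X₃ := X₃) (X₄ := X₄) hy0
    (by rw [hX₁]; linarith [hxpos 1 (by simp)]) (by rw [hX₂]; linarith [hxpos I (by simp)])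
    (by rw [hX₃, sub_eq_add_neg v]; linarith [hxpos (-1) (by simp)])
    (by rw [hX₄, sub_eq_add_neg v]; linarith [hxpos (-I) (by simp)])
    (by rw [hX₁]; linarith [hx3 1 (by simp)]) (by rw [hX₂]; linarith [hx3 I (by simp)])
    (by rw [hX₃, sub_eq_add_neg v]; linarith [hx3 (-1) (by simp)])
    (by rw [hX₄, sub_eq_add_neg v]; linarith [hx3 (-I) (by simp)]) hkey
  simpa [hX₁, hX₂, hX₃, hX₄] using key

end Estimates

end Literature.Analysis.Complex
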